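import Summits.CriticalPhenomena.PercolationContinuityZ3.Theorems.PercNearOneGluingNoHeavyRsw3SetToSetHardCrossingPatches
import Literature.Probability.Percolation.ContinuityCriterion
import Literature.Probability.Percolation.TreeGraphBound
import Literature.Probability.Percolation.LatticeSymmetry
import HarnessLib

/-!
# RSW3 lane (lead, gen 15): the OPPOSITE-FACES TEST of Basu–Sapozhnikov's (A2)□ on `ℤ³` — what (A2)□ says about two tube
# crossings and the one-arm probability (every `p`)

builds on p205010 (kernel theorem, internal audit signed; external expert review pending) — NOT used in this file.

Cell `prim-rsw3` (LANE 3), lead seat, gen 15.  Support file (`--supports stmt-CriticalPhenomena-4575`); no definitions, no named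
facts, no sorries.  Companion file `…SetToSetSubcritical` draws the consequence: (A2)□ fails for every `0 < p < p_c(ℤ³)`.

THE TEST (`mul_hardCrossing_mul_le_of_setToSetQuasiMultAspectAt`, every `p`, every aspect `s ≥ 1`, `L`, every scale `m ≥ 1`;
`K = L + s`, `R = Km + 1`).  Apply `Crossing.SetToSetQuasiMultAspectAt 3 p s L ϰ` (for all `m ≥ 1`, finite `Z ⊇ Λ(Lm) ∖ Λ(m-1)`,
`X ⊆ Z ∩ Λ(m)`, `Y ⊆ Z ∖ Λ(Lm)`: `ϰ·P_p[X ↔ ∂ⁱⁿΛ(sm) in Z]·P_p[Y ↔ ∂ⁱⁿΛ(sm) in Z] ≤ P_p[X ↔ Y in Z]`) with `Z = Λ(R)`,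
`X` = the face `{x₀ = m}` of `Λ(m)` — on the FAR side — and `Y` = the patch `{y₀ = -R, |y₁|, |y₂| ≤ m}`.  The event
`X ↔ ∂ⁱⁿΛ(sm) in Z` contains a hard crossing of the translated tube `[m, sm] × [-m, m]²`, the event `Y ↔ ∂ⁱⁿΛ(sm) in Z` one of
`[-R, -sm] × [-m, m]²` (`hardCrossing_le_real_openCrossing`: `H_p(a; n) = P_p(boxCross ![a,n,n] 0) ≤ P_p[A ↔ B in Z]` whenever the
translate `v + {0..a} × {0..n}²` lies in `Z` with its two small faces in `A` and `B` — translation invariance `bondPercolation_real_image`,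
`Rsw3.boxCross_eq_openCrossing_top_bot`, monotonicity), while `X ↔ Y` forces an open connection between two points at sup-distance
`(K+1)m + 1`, so by the union bound and first exit (`tau_le_real_siteToBoundary`) `P_p[X ↔ Y in Z] ≤ |X|·|Y|·π_p((K+1)m)`
(`real_openCrossing_le_card_mul_card_mul`).  Hence
**`ϰ · H_p((s-1)m; 2m) · H_p(Lm+1; 2m) ≤ (2m+1)³ (2Km+3)³ · π_p((K+1)m)`.**
The left side travels `(K-1)m + O(1)` lattice units, the right side `(K+1)m`: a connection from the far face must TRAVERSE the inner
box.  At `p_c` this costs nothing exponentially; below `p_c` it costs `e^{-2mφ(p)}` (companion file); above `p_c` all three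
probabilities are of order one.

References: D. Basu, A. Sapozhnikov, Electron. Commun. Probab. 22 (2017) no. 26, §1 (A2) [BasuSapozhnikov2017ECP]; H. Kesten,
*Percolation Theory for Mathematicians* (1982), §3.3 Def. 1–3 and Comment (v) [Kesten1982]; G. Grimmett, *Percolation* (1999),
§1.4, §1.6 [GrimmettPercolation1999]. [folklore]
-/

noncomputable section

namespace Summit.CriticalPhenomena.PercolationContinuityZ3.Theorems.Crossing

open MeasureTheory Filter Topology Literature.Probability.LatticeModels Literature.Probability.Percolation SimpleGraph
open Summit.CriticalPhenomena.PercolationContinuityZ3.Theorems.Rsw3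

/-! ## A translated tube crossing inside an open-crossing event -/

/-- **A translated hard crossing is an open crossing.**  If the translate `v + {0..a} × {0..n}²` of the block lies in `Z`, its
face `{x₀ = v₀}` in `A` and its face `{x₀ = v₀ + a}` in `B`, then `H_p(a; n) = P_p(boxCross ![a,n,n] 0) ≤ P_p[A ↔ B in Z]`
(translation invariance of `P_p` and monotonicity of open crossing events). [cite: Kesten1982, §3.3 Def. 1–3 and Comment (v)] -/
theorem hardCrossing_le_real_openCrossing (p : unitInterval) (a n : ℕ) (v : Site 3) {Z A B : Set (Site 3)}
    (hZ : ∀ x ∈ Finset.Icc (0 : Site 3) ![(a : ℤ), n, n], x + v ∈ Z)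
    (hA : ∀ x ∈ Finset.Icc (0 : Site 3) ![(a : ℤ), n, n], x 0 = 0 → x + v ∈ A)
    (hB : ∀ x ∈ Finset.Icc (0 : Site 3) ![(a : ℤ), n, n], x 0 = a → x + v ∈ B) :
    (bondPercolation (zdGraph 3) p).real (boxCross (![(a : ℤ), n, n] : Site 3) 0) ≤
      (bondPercolation (zdGraph 3) p).real (openCrossing Z A B) := by
  set φ : zdGraph 3 ≃g zdGraph 3 := zdShiftIso v with hφ
  rw [openCrossing_comm Z A B, boxCross_eq_openCrossing_top_bot, ← bondPercolation_real_image φ p]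
  refine measureReal_mono (openCrossing_mono ?_ ?_ ?_)
  · rintro _ ⟨x, hx, rfl⟩
    exact hZ x (Finset.mem_coe.1 hx)
  · rintro _ ⟨x, ⟨hx, hxa⟩, rfl⟩
    refine hB x hx ?_
    simpa using hxa
  · rintro _ ⟨x, ⟨hx, hx0⟩, rfl⟩
    exact hA x hx hx0


/-! ## The opposite-faces configuration: what (A2)□ says about two tubes and the one-arm probability -/

/-- Membership in `Icc 0 ![a, n, n]`, coordinatewise. [folklore] -/
theorem mem_Icc_zero_vec3_iff {a n : ℕ} {x : Site 3} :
    x ∈ Finset.Icc (0 : Site 3) ![(a : ℤ), n, n] ↔ (0 ≤ x 0 ∧ x 0 ≤ a) ∧ (0 ≤ x 1 ∧ x 1 ≤ n) ∧ (0 ≤ x 2 ∧ x 2 ≤ n) :=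
  mem_Icc_vec3_iff.trans (by
    simp only [Pi.zero_apply, Matrix.cons_val_zero, Matrix.cons_val_one, Matrix.head_cons, Matrix.cons_val_two,
      Matrix.tail_cons])

/-- A point of `Λ(r)` with first coordinate `± r` lies on the inner vertex boundary `∂ⁱⁿΛ(r)`. [folklore] -/
theorem mem_innerBoundary_box_three_of_abs_eq {r : ℕ} {x : Site 3} (hx : x ∈ box 3 r) (h0 : x 0 = r ∨ x 0 = -(r : ℤ)) :
    x ∈ innerBoundary (zdGraph 3) (box 3 r) := by
  rw [mem_innerBoundary_iff]
  refine ⟨hx, ?_⟩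
  rcases h0 with h0 | h0
  · refine ⟨x + Pi.single 0 1, fun hy => ?_, (zdGraph_adj_iff _ _).2 ⟨0, Or.inl rfl⟩⟩
    have := (mem_box.1 hy 0).2
    simp only [Pi.add_apply, Pi.single_eq_same] at this
    omega
  · refine ⟨x - Pi.single 0 1, fun hy => ?_, (zdGraph_adj_iff _ _).2 ⟨0, Or.inr (by rw [sub_add_cancel])⟩⟩
    have := (mem_box.1 hy 0).1
    simp only [Pi.sub_apply, Pi.single_eq_same] at this
    omega

/-- `P_p[X ↔ Y in Z] ≤ |X|·|Y|·max τ`: the union bound for an open crossing between finite sets, with a uniform bound `t` on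
the two-point function `τ_p(x,y)`, `x ∈ X`, `y ∈ Y`. [folklore] -/
theorem real_openCrossing_le_card_mul_card_mul (p : unitInterval) {d : ℕ} (Z : Set (Site d)) (X Y : Finset (Site d))
    {t : ℝ} (ht : ∀ x ∈ X, ∀ y ∈ Y, tau d p x y ≤ t) :
    (bondPercolation (zdGraph d) p).real (openCrossing Z ↑X ↑Y) ≤ (X.card : ℝ) * Y.card * t := by
  classical
  set μ := bondPercolation (zdGraph d) p with hμ
  haveI : IsProbabilityMeasure μ := by rw [hμ]; infer_instance
  have hsub : openCrossing Z (↑X : Set (Site d)) ↑Y ⊆ ⋃ x ∈ X, ⋃ y ∈ Y, (openConn x y : Set (BondConfig (Site d))) := by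
    rintro ω ⟨x, hx, y, hy, hω⟩
    exact Set.mem_biUnion (Finset.mem_coe.1 hx) (Set.mem_biUnion (Finset.mem_coe.1 hy) (openConnIn_subset_openConn Z x y hω))
  calc μ.real (openCrossing Z (↑X : Set (Site d)) ↑Y)
      ≤ μ.real (⋃ x ∈ X, ⋃ y ∈ Y, (openConn x y : Set (BondConfig (Site d)))) :=
        measureReal_mono hsub (measure_ne_top _ _)
    _ ≤ ∑ x ∈ X, μ.real (⋃ y ∈ Y, (openConn x y : Set (BondConfig (Site d)))) := measureReal_biUnion_finset_le _ _
    _ ≤ ∑ x ∈ X, ∑ y ∈ Y, μ.real (openConn x y) :=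
        Finset.sum_le_sum fun x _ => measureReal_biUnion_finset_le _ _
    _ ≤ ∑ x ∈ X, ∑ y ∈ Y, t := Finset.sum_le_sum fun x hx => Finset.sum_le_sum fun y hy => by
        rw [← tau_def]; exact ht x hx y hy
    _ = (X.card : ℝ) * Y.card * t := by rw [Finset.sum_const, Finset.sum_const, nsmul_eq_mul, nsmul_eq_mul]; ring

/-- **The opposite-faces test of (A2)□ on `ℤ³`** (every `p`, every aspect `s ≥ 1`, `L`, every scale `m ≥ 1`; `R = (L+s)m+1`).
Apply `SetToSetQuasiMultAspectAt 3 p s L ϰ` with `Z = Λ(R)`, `X` = the face `{x₀ = m}` of `Λ(m)`, `Y` = the patch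
`{y₀ = -R, |y₁|,|y₂| ≤ m}`, middle sphere `∂ⁱⁿΛ(sm)`.  The two factors on the left contain translated hard crossings of the tubes
`[m, sm] × [-m,m]²` and `[-R, -sm] × [-m,m]²` (probabilities `H_p((s-1)m; 2m)` and `H_p(Lm+1; 2m)`), while `X ↔ Y` forces a
connection at sup-distance `(L+s+1)m+1`, so the right side is at most `|X|·|Y|·π_p((L+s+1)m)`:
**`ϰ · H_p((s-1)m; 2m) · H_p(Lm+1; 2m) ≤ (2m+1)³ (2R+1)³ · π_p((L+s+1)m)`.**  The left side travels `(L+s-1)m + O(1)`, the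
right side `(L+s+1)m`: the inner box must be TRAVERSED, which costs `e^{-2mφ(p)}` below `p_c` and nothing at `p_c`.
[cite: BasuSapozhnikov2017ECP, §1 assumption (A2)] [cite: Kesten1982, §3.3 Comment (v)] -/
theorem mul_hardCrossing_mul_le_of_setToSetQuasiMultAspectAt (p : unitInterval) {s L : ℕ} (hs : 1 ≤ s) {ϰ : ℝ}
    (h : SetToSetQuasiMultAspectAt 3 p s L ϰ) {m : ℕ} (hm : 1 ≤ m) :
    ϰ * ((bondPercolation (zdGraph 3) p).real (boxCross (![(((s - 1) * m : ℕ) : ℤ), ((2 * m : ℕ) : ℤ), ((2 * m : ℕ) : ℤ)] : Site 3) 0) *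
        (bondPercolation (zdGraph 3) p).real (boxCross (![((L * m + 1 : ℕ) : ℤ), ((2 * m : ℕ) : ℤ), ((2 * m : ℕ) : ℤ)] : Site 3) 0)) ≤
      ((2 * m + 1 : ℕ) : ℝ) ^ 3 * ((2 * ((L + s) * m + 1) + 1 : ℕ) : ℝ) ^ 3 * oneArmProb 3 p ((L + s + 1) * m) := by
  classical
  obtain ⟨R, hR⟩ : ∃ R : ℕ, R = (L + s) * m + 1 := ⟨_, rfl⟩
  rw [show (2 * ((L + s) * m + 1) + 1 : ℕ) = 2 * R + 1 by rw [hR]]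
  set μ := bondPercolation (zdGraph 3) p with hμ
  haveI : IsProbabilityMeasure μ := by rw [hμ]; infer_instance
  set Z : Finset (Site 3) := box 3 R with hZdef
  set X : Finset (Site 3) := (box 3 m).filter (fun x => x 0 = m) with hXdef
  set Y : Finset (Site 3) := (box 3 R).filter
    (fun y => y 0 = -(R : ℤ) ∧ (-(m : ℤ) ≤ y 1 ∧ y 1 ≤ m) ∧ (-(m : ℤ) ≤ y 2 ∧ y 2 ≤ m)) with hYdef
  set S : Finset (Site 3) := innerBoundary (zdGraph 3) (box 3 (s * m)) with hSdef
  -- box membership on `ℤ³`, coordinatewise (local form)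
  have hmb : ∀ {r : ℕ} {x : Site 3}, x ∈ box 3 r ↔
      (-(r : ℤ) ≤ x 0 ∧ x 0 ≤ r) ∧ (-(r : ℤ) ≤ x 1 ∧ x 1 ≤ r) ∧ (-(r : ℤ) ≤ x 2 ∧ x 2 ≤ r) := by
    intro r x
    rw [mem_box, Fin.forall_fin_succ, Fin.forall_fin_two]
    simp only [Fin.succ_zero_eq_one, Fin.succ_one_eq_two]
  have hsm : m ≤ s * m := by nlinarith
  have hLmR : L * m ≤ R := by rw [hR]; nlinarith
  have hsmR : s * m ≤ R := by rw [hR]; nlinarith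
  have hmR : m ≤ R := hsm.trans hsmR
  -- the (A2)□ hypotheses
  have hZ : box 3 (L * m) \ box 3 (m - 1) ⊆ Z := Finset.sdiff_subset.trans (box_mono 3 hLmR)
  have hX : X ⊆ Z ∩ box 3 m := by
    intro x hx
    have hx' := (Finset.mem_filter.1 hx).1
    exact Finset.mem_inter.2 ⟨box_mono 3 hmR hx', hx'⟩
  have hY : Y ⊆ Z \ box 3 (L * m) := by
    intro y hy
    obtain ⟨hyR, hy0, -⟩ := Finset.mem_filter.1 hy
    refine Finset.mem_sdiff.2 ⟨hyR, fun hyL => ?_⟩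
    have h1 := (mem_box.1 hyL 0).1
    rw [hy0] at h1
    have h2 : (R : ℤ) ≤ L * m := by push_cast at h1; linarith
    have h3 : (L : ℤ) * m + 1 ≤ R := by rw [hR]; push_cast; nlinarith
    linarith
  have key := h m hm Z hZ X hX Y hY
  change ϰ * (μ.real (openCrossing (↑Z : Set (Site 3)) ↑X ↑S) * μ.real (openCrossing (↑Z : Set (Site 3)) ↑Y ↑S)) ≤
    μ.real (openCrossing (↑Z : Set (Site 3)) ↑X ↑Y) at key
  -- tube 1: `[m, sm] × [-m, m]²`, from the face `X` to the sphere
  have hT1 : μ.real (boxCross (![(((s - 1) * m : ℕ) : ℤ), ((2 * m : ℕ) : ℤ), ((2 * m : ℕ) : ℤ)] : Site 3) 0) ≤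
      μ.real (openCrossing (↑Z : Set (Site 3)) ↑X ↑S) := by
    have hs1 : (((s - 1) * m : ℕ) : ℤ) = (s : ℤ) * m - m := by
      rw [Nat.cast_mul, Nat.cast_sub hs]; push_cast; ring
    refine hardCrossing_le_real_openCrossing p _ _ (![(m : ℤ), -(m : ℤ), -(m : ℤ)]) ?_ ?_ ?_
    · intro x hx
      rw [mem_Icc_zero_vec3_iff] at hx
      rw [Finset.mem_coe, hZdef, hmb]
      simp only [Pi.add_apply, Matrix.cons_val_zero, Matrix.cons_val_one, Matrix.head_cons, Matrix.cons_val_two,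
        Matrix.tail_cons]
      push_cast [hs1] at hx ⊢
      have : (s : ℤ) * m ≤ R := by exact_mod_cast hsmR
      have : (m : ℤ) ≤ R := by exact_mod_cast hmR
      refine ⟨⟨by linarith [hx.1.1], by linarith [hx.1.2]⟩, ⟨by linarith [hx.2.1.1], by linarith [hx.2.1.2]⟩,
        ⟨by linarith [hx.2.2.1], by linarith [hx.2.2.2]⟩⟩
    · intro x hx hx0
      rw [mem_Icc_zero_vec3_iff] at hx
      rw [Finset.mem_coe, hXdef, Finset.mem_filter, hmb]
      simp only [Pi.add_apply, Matrix.cons_val_zero, Matrix.cons_val_one, Matrix.head_cons, Matrix.cons_val_two,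
        Matrix.tail_cons, hx0, zero_add]
      push_cast at hx ⊢
      refine ⟨⟨⟨by linarith, le_rfl⟩, ⟨by linarith [hx.2.1.1], by linarith [hx.2.1.2]⟩,
        ⟨by linarith [hx.2.2.1], by linarith [hx.2.2.2]⟩⟩, trivial⟩
    · intro x hx hxa
      rw [mem_Icc_zero_vec3_iff] at hx
      rw [Finset.mem_coe, hSdef]
      have hx0 : (x + ![(m : ℤ), -(m : ℤ), -(m : ℤ)]) 0 = ((s * m : ℕ) : ℤ) := by
        simp only [Pi.add_apply, Matrix.cons_val_zero, hxa, hs1]; push_cast; ring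
      refine mem_innerBoundary_box_three_of_abs_eq ?_ (Or.inl hx0)
      rw [hmb, hx0]
      simp only [Pi.add_apply, Matrix.cons_val_one, Matrix.head_cons, Matrix.cons_val_two, Matrix.tail_cons]
      push_cast at hx ⊢
      have : (m : ℤ) ≤ s * m := by exact_mod_cast hsm
      refine ⟨⟨by linarith, le_rfl⟩, ⟨by linarith [hx.2.1.1], by linarith [hx.2.1.2]⟩,
        ⟨by linarith [hx.2.2.1], by linarith [hx.2.2.2]⟩⟩
  -- tube 2: `[-R, -sm] × [-m, m]²`, from the patch `Y` to the sphere
  have hT2 : μ.real (boxCross (![((L * m + 1 : ℕ) : ℤ), ((2 * m : ℕ) : ℤ), ((2 * m : ℕ) : ℤ)] : Site 3) 0) ≤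
      μ.real (openCrossing (↑Z : Set (Site 3)) ↑Y ↑S) := by
    have hR' : (R : ℤ) = (L : ℤ) * m + s * m + 1 := by rw [hR]; push_cast; ring
    refine hardCrossing_le_real_openCrossing p _ _ (![-(R : ℤ), -(m : ℤ), -(m : ℤ)]) ?_ ?_ ?_
    · intro x hx
      rw [mem_Icc_zero_vec3_iff] at hx
      rw [Finset.mem_coe, hZdef, hmb]
      simp only [Pi.add_apply, Matrix.cons_val_zero, Matrix.cons_val_one, Matrix.head_cons, Matrix.cons_val_two,
        Matrix.tail_cons]
      push_cast at hx ⊢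
      have : (m : ℤ) ≤ R := by exact_mod_cast hmR
      refine ⟨⟨by linarith [hx.1.1], by linarith [hx.1.2]⟩, ⟨by linarith [hx.2.1.1], by linarith [hx.2.1.2]⟩,
        ⟨by linarith [hx.2.2.1], by linarith [hx.2.2.2]⟩⟩
    · intro x hx hx0
      rw [mem_Icc_zero_vec3_iff] at hx
      rw [Finset.mem_coe, hYdef, Finset.mem_filter, hmb]
      simp only [Pi.add_apply, Matrix.cons_val_zero, Matrix.cons_val_one, Matrix.head_cons, Matrix.cons_val_two,
        Matrix.tail_cons, hx0, zero_add]
      push_cast at hx ⊢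
      have : (m : ℤ) ≤ R := by exact_mod_cast hmR
      refine ⟨⟨⟨le_rfl, by linarith⟩, ⟨by linarith [hx.2.1.1], by linarith [hx.2.1.2]⟩,
        ⟨by linarith [hx.2.2.1], by linarith [hx.2.2.2]⟩⟩, trivial, ⟨by linarith [hx.2.1.1], by linarith [hx.2.1.2]⟩,
        ⟨by linarith [hx.2.2.1], by linarith [hx.2.2.2]⟩⟩
    · intro x hx hxa
      rw [mem_Icc_zero_vec3_iff] at hx
      rw [Finset.mem_coe, hSdef]
      have hx0 : (x + ![-(R : ℤ), -(m : ℤ), -(m : ℤ)]) 0 = -((s * m : ℕ) : ℤ) := by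
        simp only [Pi.add_apply, Matrix.cons_val_zero, hxa, hR']; push_cast; ring
      refine mem_innerBoundary_box_three_of_abs_eq ?_ (Or.inr hx0)
      rw [hmb, hx0]
      simp only [Pi.add_apply, Matrix.cons_val_one, Matrix.head_cons, Matrix.cons_val_two, Matrix.tail_cons]
      push_cast at hx ⊢
      have : (m : ℤ) ≤ s * m := by exact_mod_cast hsm
      refine ⟨⟨le_rfl, by linarith⟩, ⟨by linarith [hx.2.1.1], by linarith [hx.2.1.2]⟩,
        ⟨by linarith [hx.2.2.1], by linarith [hx.2.2.2]⟩⟩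
  -- the right-hand side: union bound and first exit
  have hRHS : μ.real (openCrossing (↑Z : Set (Site 3)) ↑X ↑Y) ≤
      ((2 * m + 1 : ℕ) : ℝ) ^ 3 * ((2 * R + 1 : ℕ) : ℝ) ^ 3 * oneArmProb 3 p ((L + s + 1) * m) := by
    have ht : ∀ x ∈ X, ∀ y ∈ Y, tau 3 p x y ≤ oneArmProb 3 p ((L + s + 1) * m) := by
      intro x hx y hy
      obtain ⟨-, hx0⟩ := Finset.mem_filter.1 hx
      obtain ⟨-, hy0, -⟩ := Finset.mem_filter.1 hy
      rw [tau_eq_tau_zero_sub]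
      refine tau_le_real_siteToBoundary p fun hmem => ?_
      have h1 := (mem_box.1 hmem 0).1
      rw [Pi.sub_apply, hy0, hx0] at h1
      have h3 : (R : ℤ) = (L : ℤ) * m + s * m + 1 := by rw [hR]; push_cast; ring
      rw [h3] at h1
      push_cast at h1
      nlinarith
    refine (real_openCrossing_le_card_mul_card_mul p _ X Y ht).trans ?_
    have hXc : (X.card : ℝ) ≤ ((2 * m + 1 : ℕ) : ℝ) ^ 3 := by
      have hsub : X ⊆ box 3 m := by rw [hXdef]; exact Finset.filter_subset _ _
      have := (Finset.card_le_card hsub).trans_eq (card_box 3 m)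
      exact_mod_cast this
    have hYc : (Y.card : ℝ) ≤ ((2 * R + 1 : ℕ) : ℝ) ^ 3 := by
      have hsub : Y ⊆ box 3 R := by rw [hYdef]; exact Finset.filter_subset _ _
      have := (Finset.card_le_card hsub).trans_eq (card_box 3 R)
      exact_mod_cast this
    have hπ : 0 ≤ oneArmProb 3 p ((L + s + 1) * m) := measureReal_nonneg
    exact mul_le_mul (mul_le_mul hXc hYc (by positivity) (by positivity)) le_rfl hπ (by positivity)
  -- assemble
  by_cases hϰ : 0 ≤ ϰ
  · calc ϰ * (μ.real (boxCross (![(((s - 1) * m : ℕ) : ℤ), ((2 * m : ℕ) : ℤ), ((2 * m : ℕ) : ℤ)] : Site 3) 0) *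
          μ.real (boxCross (![((L * m + 1 : ℕ) : ℤ), ((2 * m : ℕ) : ℤ), ((2 * m : ℕ) : ℤ)] : Site 3) 0))
        ≤ ϰ * (μ.real (openCrossing (↑Z : Set (Site 3)) ↑X ↑S) * μ.real (openCrossing (↑Z : Set (Site 3)) ↑Y ↑S)) :=
          mul_le_mul_of_nonneg_left (mul_le_mul hT1 hT2 measureReal_nonneg measureReal_nonneg) hϰ
      _ ≤ μ.real (openCrossing (↑Z : Set (Site 3)) ↑X ↑Y) := key
      _ ≤ _ := hRHS
  · rw [not_le] at hϰ
    have h1 : ϰ * (μ.real (boxCross (![(((s - 1) * m : ℕ) : ℤ), ((2 * m : ℕ) : ℤ), ((2 * m : ℕ) : ℤ)] : Site 3) 0) *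
        μ.real (boxCross (![((L * m + 1 : ℕ) : ℤ), ((2 * m : ℕ) : ℤ), ((2 * m : ℕ) : ℤ)] : Site 3) 0)) ≤ 0 :=
      mul_nonpos_of_nonpos_of_nonneg hϰ.le (mul_nonneg measureReal_nonneg measureReal_nonneg)
    have hπ : 0 ≤ oneArmProb 3 p ((L + s + 1) * m) := measureReal_nonneg
    exact h1.trans (mul_nonneg (by positivity) hπ)


end Summit.CriticalPhenomena.PercolationContinuityZ3.Theorems.Crossing
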